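import Literature.Analysis.Matrix.LogDetMixedDifference
import Mathlib.Analysis.Calculus.Deriv.Prod
import Mathlib.Analysis.Calculus.Deriv.Comp
import Mathlib.Analysis.Calculus.FDeriv.Prod
import HarnessLib

/-!
# Localised response: propagation of exponential localisation through a Combes–Thomas kernel
# (the linear-algebra half of the «localised response of the background field to a local perturbation»)

Topic `Literature/Analysis/Matrix`; namespace `Literature.Analysis.Matrix`.  Sibling of `CoerciveCombesThomas.lean`
(which PRODUCES the kernel bound `|A⁻¹ k l| ≤ (2∕g)·e^{−θ·dist k l}` for a gapped finite-range matrix) and of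
`LogDetMixedDifference.lean` (imported; it CONSUMES block-localised variations in `Δ² log det`).  Everything here is PROVED;
no definitions, no named facts; real entries; an `ℕ`-valued pseudo-distance `dist` on a finite index type (only the
triangle inequality is ever used, and only where stated).  «`k` is `R`-far from the finite set `I`» is spelled
`∀ l ∈ I, R ≤ dist k l`; an «exponential profile around a set» is any `d : n → ℕ` with the 1-Lipschitz row
`d k ≤ dist k l + d l` (e.g. the distance to a set) — no set-distance is defined.

THE MECHANISM ([Balaban1985Variational] Thm 1, (10) p. 279; [Balaban1984PropagatorsII] (1.33)).  A non-degenerate critical point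
`m(s)` of a finite-range functional depends on `s` only through the «bond» block `I`: differentiating `G(s, m(s)) = 0` gives the
RESPONSE ROW `∂ₛG + A·m′ = 0` (`A` the Hessian), so `m′ = −A⁻¹ ∂ₛG`, and the Combes–Thomas decay of `A⁻¹` with the support of
`∂ₛG` in `I` make `m′` exponentially small away from `I`.  This file types that linear algebra (and the chain rule producing the
row), NOT the existence or differentiability of the critical branch (an implicit-function statement about the specific functional).

* §1 PROPAGATION — `abs_mulVec_le_sum_of_support`, ★`abs_mulVec_le_of_support_far` (kernel × block-supported vector, read
  `R`-far from the block: `≤ C·η·|I|·e^{−θR}`), ★`abs_mulVec_le_of_expLocalised` (kernel × exponentially localised vector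
  is exponentially localised with half the rate, constant = a row-sum bound `N` of `e^{−(θ∕2)·dist}`).
* §2 THE RESPONSE ROW — ★★`abs_response_le_of_row_far` ∕ `abs_response_le_of_row_sum` (from `w + A *ᵥ m′ = 0`, `det A ≠ 0`,
  Combes–Thomas decay of `A⁻¹`, `w` supported in `I` with `|w| ≤ δ`: `|m′ k| ≤ C·δ·|I|·e^{−θR}` for `k` `R`-far from `I`),
  `abs_response_le_of_row_expLocalised` (the same with an exponentially localised source — the shape of the second-order row),
  and the chain-rule door ★`response_row_of_hasDerivAt` (`HasFDerivAt (uncurry G) G' (s₀, m s₀)`, `HasDerivAt m m′ s₀`,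
  `G s (m s) = 0` near `s₀` ⟹ `G' (1,0) + G' (0,m′) = 0`) with its matrix reading `response_row_matrix_of_hasDerivAt`.
* §3 THE EXPONENTIALLY LOCALISED 4-FACTOR TRACE BOUND — ★★`abs_trace_mul4_le_of_expLocalised`: the edition of
  `LogDetMixedDifference.abs_trace_mul4_le_of_blocks` in which the two variations `E`, `D` are exponentially localised near
  two profiles `d'`, `d` (not block-supported) and ONE outer factor carries Combes–Thomas decay:
  `|tr(A E B D)| ≤ |n|⁴·α·ε·β·δ·e^{−θR}` whenever `R ≤ d a + dist a b + d' b` for all `a b` (the profiles are `R` apart).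
* §4 ★`abs_mulVec_le_of_range_expLocalised(_far)` (range-`r` operator near one profile × vector near another ⟹ near both),
  ★★`abs_mixedResponse_le` (the mixed row `u + P·mₛ + A·mₛₜ = 0` ⟹ `|mₛₜ| ≤ |n|·C·(μ + |n|·p·η·e^{θr}·e^{−θR})`).
  For the distance-to-a-set profiles `k ↦ inf_{i ∈ I} dist k i` the rows `hd` (triangle inequality), `hsep` (symmetry +
  triangle inequality + `dist(I, I′) ≥ R`) and the block-to-profile conversion `Σ_{i∈I} e^{−θ·dist l i} ≤ |I|·e^{−θ·inf}` are
  three-line checks left to the consumer (they are not citable statements).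

HONEST SCOPE: finite-dimensional linear algebra, one chain rule (consumer: cell `ym3-torus`, 20520 S2β letter DECAY — the
localisation rows of the one-loop rectangle).  Nothing here bears on the Yang–Mills mass gap (Clay), which is NOT proved.

References: T. Bałaban, CMP 102 (1985) 277, Thm 1, (10) p. 279 [Balaban1985Variational]; CMP 96 (1984) 223, (1.33)
[Balaban1984PropagatorsII]; M. Aizenman, S. Warzel, *Random Operators* (2015) §10.3 [AizenmanWarzel2015];
R. A. Horn, C. R. Johnson, *Matrix Analysis* (2013) §0.7, §5.6 [HornJohnson2013]; W. Rudin, *Principles of Mathematical Analysis*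
(3rd ed. 1976) Thm 9.28 [Rudin1976].
-/

noncomputable section

open Matrix Finset
open scoped Matrix

namespace Literature.Analysis.Matrix

variable {n : Type*} [Fintype n] [DecidableEq n]

/-! ## §1 Propagation of localisation through a kernel with exponential off-diagonal decay -/

omit [DecidableEq n] in
/-- Kernel with exponential off-diagonal decay applied to a vector supported in `I` with entries `≤ η`:
`|(K v) k| ≤ C·η·Σ_{l ∈ I} e^{−θ·dist k l}`. [cite: AizenmanWarzel2015, §10.3 (Combes–Thomas estimate, use of)] -/
theorem abs_mulVec_le_sum_of_support (dist : n → n → ℕ) {K : Matrix n n ℝ} {C θ : ℝ} (hC : 0 ≤ C)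
    (hK : ∀ k l, |K k l| ≤ C * Real.exp (-(θ * dist k l)))
    {I : Finset n} {v : n → ℝ} {η : ℝ} (hv0 : ∀ l, l ∉ I → v l = 0) (hvb : ∀ l ∈ I, |v l| ≤ η)
    (k : n) :
    |(K *ᵥ v) k| ≤ C * η * ∑ l ∈ I, Real.exp (-(θ * dist k l)) := by
  rw [Matrix.mulVec, dotProduct]
  have hzero : ∀ l ∈ (univ : Finset n), l ∉ I → K k l * v l = 0 := fun l _ hl => by rw [hv0 l hl, mul_zero]
  rw [← Finset.sum_subset (Finset.subset_univ I) hzero, Finset.mul_sum]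
  refine (Finset.abs_sum_le_sum_abs _ _).trans (Finset.sum_le_sum fun l hl => ?_)
  rw [abs_mul]
  calc |K k l| * |v l| ≤ C * Real.exp (-(θ * dist k l)) * η :=
        mul_le_mul (hK k l) (hvb l hl) (abs_nonneg _) (mul_nonneg hC (Real.exp_nonneg _))
    _ = C * η * Real.exp (-(θ * dist k l)) := by ring

omit [DecidableEq n] in
/-- ★ **Kernel × block-supported vector, read far from the block.**  If `|K k l| ≤ C·e^{−θ·dist k l}`, `v` is supported in
`I` with `|v| ≤ η`, and `k` is `R`-far from `I` (`R ≤ dist k l` for all `l ∈ I`), then `|(K v) k| ≤ C·η·|I|·e^{−θR}`.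
[cite: AizenmanWarzel2015, §10.3] -/
theorem abs_mulVec_le_of_support_far (dist : n → n → ℕ) {K : Matrix n n ℝ} {C θ : ℝ} (hC : 0 ≤ C) (hθ : 0 ≤ θ)
    (hK : ∀ k l, |K k l| ≤ C * Real.exp (-(θ * dist k l)))
    {I : Finset n} {v : n → ℝ} {η : ℝ} (hη : 0 ≤ η) (hv0 : ∀ l, l ∉ I → v l = 0) (hvb : ∀ l ∈ I, |v l| ≤ η)
    {k : n} {R : ℕ} (hR : ∀ l ∈ I, R ≤ dist k l) :
    |(K *ᵥ v) k| ≤ C * η * I.card * Real.exp (-(θ * R)) := by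
  refine (abs_mulVec_le_sum_of_support dist hC hK hv0 hvb k).trans ?_
  have hsum : ∑ l ∈ I, Real.exp (-(θ * dist k l)) ≤ ∑ _l ∈ I, Real.exp (-(θ * R)) := by
    refine Finset.sum_le_sum fun l hl => Real.exp_le_exp.2 ?_
    have : (R : ℝ) ≤ dist k l := by exact_mod_cast hR l hl
    nlinarith
  rw [Finset.sum_const, nsmul_eq_mul] at hsum
  calc C * η * ∑ l ∈ I, Real.exp (-(θ * dist k l)) ≤ C * η * (I.card * Real.exp (-(θ * R))) :=
        mul_le_mul_of_nonneg_left hsum (mul_nonneg hC hη)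
    _ = C * η * I.card * Real.exp (-(θ * R)) := by ring

omit [DecidableEq n] in
/-- ★ **Kernel × exponentially localised vector.**  If `|K k l| ≤ C·e^{−θ·dist k l}` (`θ ≥ 0`), the input is localised along
a 1-Lipschitz profile `d` (`d k ≤ dist k l + d l`; e.g. the distance to a set) as `|v l| ≤ η·e^{−θ·d l}`, and `N` bounds the
half-rate row sums `Σ_l e^{−(θ∕2)·dist k l} ≤ N`, then the output is localised along the same profile at half the rate:
`|(K v) k| ≤ C·η·N·e^{−(θ∕2)·d k}`.  (Split `θ·dist + θ·d l ≥ (θ∕2)·dist + (θ∕2)·d k`.) [cite: AizenmanWarzel2015, §10.3] -/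
theorem abs_mulVec_le_of_expLocalised (dist : n → n → ℕ) {K : Matrix n n ℝ} {C θ : ℝ} (hC : 0 ≤ C) (hθ : 0 ≤ θ)
    (hK : ∀ k l, |K k l| ≤ C * Real.exp (-(θ * dist k l)))
    {d : n → ℕ} (hd : ∀ k l, d k ≤ dist k l + d l)
    {v : n → ℝ} {η : ℝ} (hη : 0 ≤ η) (hv : ∀ l, |v l| ≤ η * Real.exp (-(θ * d l)))
    {N : ℝ} (hN : ∀ k, ∑ l, Real.exp (-(θ / 2 * dist k l)) ≤ N) (k : n) :
    |(K *ᵥ v) k| ≤ C * η * N * Real.exp (-(θ / 2 * d k)) := by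
  rw [Matrix.mulVec, dotProduct]
  refine (Finset.abs_sum_le_sum_abs _ _).trans ?_
  have hterm : ∀ l, |K k l * v l| ≤
      C * η * Real.exp (-(θ / 2 * d k)) * Real.exp (-(θ / 2 * dist k l)) := by
    intro l
    rw [abs_mul]
    have h1 : |K k l| * |v l| ≤ C * Real.exp (-(θ * dist k l)) * (η * Real.exp (-(θ * d l))) :=
      mul_le_mul (hK k l) (hv l) (abs_nonneg _) (mul_nonneg hC (Real.exp_nonneg _))
    refine h1.trans ?_
    have hdk : (d k : ℝ) ≤ dist k l + d l := by exact_mod_cast hd k l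
    have hexp : Real.exp (-(θ * dist k l)) * Real.exp (-(θ * d l)) ≤
        Real.exp (-(θ / 2 * d k)) * Real.exp (-(θ / 2 * dist k l)) := by
      rw [← Real.exp_add, ← Real.exp_add]
      refine Real.exp_le_exp.2 ?_
      have h0 : 0 ≤ θ / 2 * (d l : ℝ) := by positivity
      nlinarith
    calc C * Real.exp (-(θ * dist k l)) * (η * Real.exp (-(θ * d l)))
        = C * η * (Real.exp (-(θ * dist k l)) * Real.exp (-(θ * d l))) := by ring
      _ ≤ C * η * (Real.exp (-(θ / 2 * d k)) * Real.exp (-(θ / 2 * dist k l))) :=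
          mul_le_mul_of_nonneg_left hexp (mul_nonneg hC hη)
      _ = C * η * Real.exp (-(θ / 2 * d k)) * Real.exp (-(θ / 2 * dist k l)) := by ring
  calc ∑ l, |K k l * v l| ≤ ∑ l, C * η * Real.exp (-(θ / 2 * d k)) * Real.exp (-(θ / 2 * dist k l)) :=
        Finset.sum_le_sum fun l _ => hterm l
    _ = C * η * Real.exp (-(θ / 2 * d k)) * ∑ l, Real.exp (-(θ / 2 * dist k l)) := by rw [Finset.mul_sum]
    _ ≤ C * η * Real.exp (-(θ / 2 * d k)) * N :=
        mul_le_mul_of_nonneg_left (hN k) (by positivity)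
    _ = C * η * N * Real.exp (-(θ / 2 * d k)) := by ring

/-! ## §2 The response row `w + A·m′ = 0` and the localisation of the first-order response -/

/-- From the response row `w + A *ᵥ m′ = 0` with `det A ≠ 0`: `m′ = −(A⁻¹ *ᵥ w)`. [cite: HornJohnson2013, §0.7 (inverse)] -/
theorem response_eq_neg_inv_mulVec {A : Matrix n n ℝ} (hA : IsUnit A.det) {w m' : n → ℝ}
    (hrow : w + A *ᵥ m' = 0) : m' = -(A⁻¹ *ᵥ w) := by
  calc m' = (A⁻¹ * A) *ᵥ m' := by rw [Matrix.nonsing_inv_mul _ hA, Matrix.one_mulVec]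
    _ = -(A⁻¹ *ᵥ w) := by rw [← Matrix.mulVec_mulVec, eq_neg_of_add_eq_zero_right hrow, Matrix.mulVec_neg]

/-- The response row with a source supported in `I`, sum form: `|m′ k| ≤ C·δ·Σ_{l ∈ I} e^{−θ·dist k l}` whenever
`w + A *ᵥ m′ = 0`, `det A ≠ 0`, `|A⁻¹ k l| ≤ C·e^{−θ·dist k l}` (Combes–Thomas, e.g. `C = 2∕g` from
`CoerciveCombesThomas.coercive_combes_thomas`), `w` vanishes off `I` and `|w| ≤ δ` on `I`.
[cite: Balaban1985Variational, Thm 1 (10) p. 279 (localised response, linear-algebra step)] -/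
theorem abs_response_le_of_row_sum (dist : n → n → ℕ) {A : Matrix n n ℝ} (hA : IsUnit A.det) {C θ : ℝ} (hC : 0 ≤ C)
    (hinv : ∀ k l, |A⁻¹ k l| ≤ C * Real.exp (-(θ * dist k l)))
    {w m' : n → ℝ} (hrow : w + A *ᵥ m' = 0)
    {I : Finset n} {δ : ℝ} (hw0 : ∀ l, l ∉ I → w l = 0) (hwb : ∀ l ∈ I, |w l| ≤ δ) (k : n) :
    |m' k| ≤ C * δ * ∑ l ∈ I, Real.exp (-(θ * dist k l)) := by
  rw [response_eq_neg_inv_mulVec hA hrow, Pi.neg_apply, abs_neg]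
  exact abs_mulVec_le_sum_of_support dist hC hinv hw0 hwb k

/-- ★★ **LOCALISATION OF THE FIRST-ORDER RESPONSE.**  If `w + A *ᵥ m′ = 0` (the differentiated criticality equation, however
obtained — see `response_row_of_hasDerivAt`), `det A ≠ 0`, the inverse has Combes–Thomas decay `|A⁻¹ k l| ≤ C·e^{−θ·dist k l}`
(`θ ≥ 0`), and the source `w` is supported in the block `I` with `|w| ≤ δ` there, then at every index `k` that is `R`-far from `I`
(`R ≤ dist k l` for all `l ∈ I`): `|m′ k| ≤ C·δ·|I|·e^{−θR}` — the response of a non-degenerate critical point to a perturbation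
entering through the block `I` is exponentially small away from `I`. [cite: Balaban1985Variational, Thm 1 (10) p. 279] -/
theorem abs_response_le_of_row_far (dist : n → n → ℕ) {A : Matrix n n ℝ} (hA : IsUnit A.det) {C θ : ℝ} (hC : 0 ≤ C)
    (hθ : 0 ≤ θ) (hinv : ∀ k l, |A⁻¹ k l| ≤ C * Real.exp (-(θ * dist k l)))
    {w m' : n → ℝ} (hrow : w + A *ᵥ m' = 0)
    {I : Finset n} {δ : ℝ} (hδ : 0 ≤ δ) (hw0 : ∀ l, l ∉ I → w l = 0) (hwb : ∀ l ∈ I, |w l| ≤ δ)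
    {k : n} {R : ℕ} (hR : ∀ l ∈ I, R ≤ dist k l) :
    |m' k| ≤ C * δ * I.card * Real.exp (-(θ * R)) := by
  rw [response_eq_neg_inv_mulVec hA hrow, Pi.neg_apply, abs_neg]
  exact abs_mulVec_le_of_support_far dist hC hθ hinv hδ hw0 hwb hR

/-- The response row with an EXPONENTIALLY LOCALISED source (the shape of the second-order ∕ mixed row, whose source is the
first-order response read through a finite-range operator): `w + A *ᵥ m′ = 0`, `det A ≠ 0`, `|A⁻¹ k l| ≤ C·e^{−θ·dist k l}`,
`|w l| ≤ η·e^{−θ·d l}` along a 1-Lipschitz profile `d`, row sums `Σ_l e^{−(θ∕2)·dist k l} ≤ N` ⟹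
`|m′ k| ≤ C·η·N·e^{−(θ∕2)·d k}`. [cite: Balaban1985Variational, Thm 1 (10) p. 279] -/
theorem abs_response_le_of_row_expLocalised (dist : n → n → ℕ) {A : Matrix n n ℝ} (hA : IsUnit A.det) {C θ : ℝ}
    (hC : 0 ≤ C) (hθ : 0 ≤ θ) (hinv : ∀ k l, |A⁻¹ k l| ≤ C * Real.exp (-(θ * dist k l)))
    {w m' : n → ℝ} (hrow : w + A *ᵥ m' = 0)
    {d : n → ℕ} (hd : ∀ k l, d k ≤ dist k l + d l) {η : ℝ} (hη : 0 ≤ η)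
    (hw : ∀ l, |w l| ≤ η * Real.exp (-(θ * d l)))
    {N : ℝ} (hN : ∀ k, ∑ l, Real.exp (-(θ / 2 * dist k l)) ≤ N) (k : n) :
    |m' k| ≤ C * η * N * Real.exp (-(θ / 2 * d k)) := by
  rw [response_eq_neg_inv_mulVec hA hrow, Pi.neg_apply, abs_neg]
  exact abs_mulVec_le_of_expLocalised dist hC hθ hinv hd hη hw hN k

omit [Fintype n] [DecidableEq n] in
/-- ★ **The chain-rule door producing the response row.**  Let `G : ℝ → V → W` be Fréchet differentiable as a function of
`(s, u)` at `(s₀, m s₀)` with derivative `G'`, let the branch `m : ℝ → V` be differentiable at `s₀` with derivative `m′`,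
and let `G s (m s) = 0` for `s` near `s₀` (a branch of critical points ∕ solutions).  Then `G' (1, 0) + G' (0, m′) = 0`:
the `s`-partial plus the `u`-partial applied to the response vanish.  (The existence and differentiability of the branch —
the implicit function theorem for the specific `G` — is NOT provided here; this is the differentiated identity behind the
formula `g′ = −(A_x)⁻¹ A_y` of the implicit function theorem.) [cite: Rudin1976, Thm 9.28 (implicit function theorem, derivative formula)] -/
theorem response_row_of_hasDerivAt {V W : Type*} [NormedAddCommGroup V] [NormedSpace ℝ V] [NormedAddCommGroup W]
    [NormedSpace ℝ W] {G : ℝ → V → W} {G' : ℝ × V →L[ℝ] W} {m : ℝ → V} {m' : V} {s₀ : ℝ}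
    (hG : HasFDerivAt (Function.uncurry G) G' (s₀, m s₀)) (hm : HasDerivAt m m' s₀)
    (hcrit : ∀ᶠ s in nhds s₀, G s (m s) = 0) :
    G' (1, 0) + G' (0, m') = 0 := by
  -- the curve `s ↦ (s, m s)` has derivative `(1, m′)`
  have hφ : HasDerivAt (fun s => (s, m s)) ((1 : ℝ), m') s₀ := (hasDerivAt_id s₀).prodMk hm
  -- so `s ↦ G s (m s)` has derivative `G' (1, m′)`
  have hcomp : HasDerivAt (fun s => G s (m s)) (G' ((1 : ℝ), m')) s₀ := by
    have h := hG.comp_hasDerivAt s₀ hφ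
    simpa [Function.comp_def, Function.uncurry] using h
  -- but it is eventually `0`, hence its derivative is `0`
  have hzero : HasDerivAt (fun s => G s (m s)) (0 : W) s₀ :=
    (hasDerivAt_const s₀ (0 : W)).congr_of_eventuallyEq hcrit
  have huniq : G' ((1 : ℝ), m') = 0 := hcomp.unique hzero
  rwa [show ((1 : ℝ), m') = ((1 : ℝ), (0 : V)) + ((0 : ℝ), m') by simp, map_add] at huniq

omit [DecidableEq n] in
/-- The matrix reading of the chain-rule door: if in addition the `u`-partial of `G'` acts as the matrix `A`
(`G' (0, v) = A *ᵥ v` for all `v`, i.e. `A` is the Hessian ∕ Jacobian in coordinates) then, with `w := G' (1, 0)` the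
`s`-partial, the response row `w + A *ᵥ m′ = 0` holds — the hypothesis of `abs_response_le_of_row_far`.
[cite: Rudin1976, Thm 9.28 (implicit function theorem, derivative formula)] -/
theorem response_row_matrix_of_hasDerivAt
    {G : ℝ → (n → ℝ) → (n → ℝ)} {G' : ℝ × (n → ℝ) →L[ℝ] (n → ℝ)} {m : ℝ → (n → ℝ)}
    {m' : n → ℝ} {s₀ : ℝ} (hG : HasFDerivAt (Function.uncurry G) G' (s₀, m s₀)) (hm : HasDerivAt m m' s₀)
    (hcrit : ∀ᶠ s in nhds s₀, G s (m s) = 0) {A : Matrix n n ℝ} (hAG : ∀ v, G' (0, v) = A *ᵥ v) :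
    G' (1, 0) + A *ᵥ m' = 0 := by
  rw [← hAG m']
  exact response_row_of_hasDerivAt hG hm hcrit

/-! ## §3 The exponentially localised 4-factor trace bound (edition of `abs_trace_mul4_le_of_blocks`) -/

omit [DecidableEq n] in
/-- ★★ **THE EXPONENTIALLY LOCALISED 4-FACTOR TRACE BOUND.**  Let `A` carry Combes–Thomas decay `|A a b| ≤ α·e^{−θ·dist a b}`
(`θ ≥ 0`), `|B| ≤ β` globally, and let the two variations be exponentially localised along profiles `d` (near the first
bond) and `d'` (near the second): `|D x a| ≤ δ·e^{−θ·d a}` (column profile) and `|E b c| ≤ ε·e^{−θ·d' b}` (row profile).  If the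
two profiles are `R` apart through `dist` — `R ≤ d a + dist a b + d' b` for all `a b` (for distances to two sets `I`, `I′` this is
`R ≤ dist(I, I′)` by the triangle inequality) — then `|tr(A E B D)| ≤ |n|⁴·α·ε·β·δ·e^{−θR}`.  This is the form in which the
resolvent term of `Δ² log det` is used when the variations of the Hessian come from a background field that RESPONDS to the
bond move with an exponential tail instead of a block support. [cite: Balaban1985Variational, Thm 1 (10) p. 279]
[cite: GlimmJaffe1987, §18.2 (cluster expansion bookkeeping)] -/
theorem abs_trace_mul4_le_of_expLocalised (dist : n → n → ℕ) {A E B D : Matrix n n ℝ} {α ε β δ θ : ℝ}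
    (hα : 0 ≤ α) (hε : 0 ≤ ε) (hβ : 0 ≤ β) (hδ : 0 ≤ δ) (hθ : 0 ≤ θ)
    (hA : ∀ a b, |A a b| ≤ α * Real.exp (-(θ * dist a b))) (hB : ∀ c d, |B c d| ≤ β)
    {d d' : n → ℕ} (hD : ∀ x a, |D x a| ≤ δ * Real.exp (-(θ * d a)))
    (hE : ∀ b c, |E b c| ≤ ε * Real.exp (-(θ * d' b)))
    {R : ℕ} (hsep : ∀ a b, R ≤ d a + dist a b + d' b) :
    |(A * E * B * D).trace| ≤ (Fintype.card n : ℝ) ^ 4 * α * ε * β * δ * Real.exp (-(θ * R)) := by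
  refine (abs_trace_mul4_le_sum A E B D).trans ?_
  have hterm : ∀ a b c x, |A a b| * |E b c| * |B c x| * |D x a| ≤ α * ε * β * δ * Real.exp (-(θ * R)) := by
    intro a b c x
    have hexp : Real.exp (-(θ * dist a b)) * Real.exp (-(θ * d' b)) * Real.exp (-(θ * d a)) ≤
        Real.exp (-(θ * R)) := by
      rw [← Real.exp_add, ← Real.exp_add]
      refine Real.exp_le_exp.2 ?_
      have h : (R : ℝ) ≤ d a + dist a b + d' b := by exact_mod_cast hsep a b
      nlinarith
    calc |A a b| * |E b c| * |B c x| * |D x a|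
        ≤ (α * Real.exp (-(θ * dist a b))) * (ε * Real.exp (-(θ * d' b))) * β * (δ * Real.exp (-(θ * d a))) := by
          have h1 := hA a b
          have h2 := hE b c
          have h3 := hB c x
          have h4 := hD x a
          have h0 : 0 ≤ α * Real.exp (-(θ * dist a b)) := by positivity
          have h0' : 0 ≤ ε * Real.exp (-(θ * d' b)) := by positivity
          gcongr
      _ = α * ε * β * δ * (Real.exp (-(θ * dist a b)) * Real.exp (-(θ * d' b)) * Real.exp (-(θ * d a))) := by ring
      _ ≤ α * ε * β * δ * Real.exp (-(θ * R)) := mul_le_mul_of_nonneg_left hexp (by positivity)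
  calc ∑ a, ∑ b, ∑ c, ∑ x, |A a b| * |E b c| * |B c x| * |D x a|
      ≤ ∑ _a : n, ∑ _b : n, ∑ _c : n, ∑ _x : n, α * ε * β * δ * Real.exp (-(θ * R)) :=
        Finset.sum_le_sum fun a _ => Finset.sum_le_sum fun b _ => Finset.sum_le_sum fun c _ =>
          Finset.sum_le_sum fun x _ => hterm a b c x
    _ = (Fintype.card n : ℝ) ^ 4 * α * ε * β * δ * Real.exp (-(θ * R)) := by
        simp only [Finset.sum_const, Finset.card_univ, nsmul_eq_mul]
        ring


/-! ## §4 Products of two localisations; the mixed (second-order) response row -/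

omit [DecidableEq n] in
/-- Entrywise-bounded kernel applied to an entrywise-bounded vector: `|(K z) k| ≤ |n|·C·ζ`. [cite: HornJohnson2013, §5.6] -/
theorem abs_mulVec_le_card_mul (K : Matrix n n ℝ) {C ζ : ℝ} (hK : ∀ k l, |K k l| ≤ C) {z : n → ℝ}
    (hz : ∀ l, |z l| ≤ ζ) (k : n) : |(K *ᵥ z) k| ≤ Fintype.card n * C * ζ := by
  rw [Matrix.mulVec, dotProduct]
  refine (Finset.abs_sum_le_sum_abs _ _).trans ?_
  calc ∑ l, |K k l * z l| ≤ ∑ _l : n, C * ζ := Finset.sum_le_sum fun l _ => by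
          rw [abs_mul]; exact mul_le_mul (hK k l) (hz l) (abs_nonneg _) ((abs_nonneg _).trans (hK k l))
    _ = Fintype.card n * C * ζ := by rw [Finset.sum_const, Finset.card_univ, nsmul_eq_mul]; ring

omit [DecidableEq n] in
/-- ★ **A range-`r` operator localised near one profile, applied to a vector localised near another, is localised near BOTH.**
`P k l ≠ 0 → dist k l ≤ r`, `|P k l| ≤ p·e^{−θ·d′ k}`, `|v l| ≤ η·e^{−θ·d l}` with `d` 1-Lipschitz ⟹
`|(P v) k| ≤ |n|·p·η·e^{θr}·e^{−θ·(d′ k + d k)}`.  (In the mixed response this is the term `(∂ₜA)·mₛ`: the `t`-variation of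
the Hessian lives near the second bond, the first-order response near the first.) [cite: Balaban1985Variational, Thm 1 (10) p. 279] -/
theorem abs_mulVec_le_of_range_expLocalised (dist : n → n → ℕ) {P : Matrix n n ℝ} {p θ : ℝ} {r : ℕ} (hp : 0 ≤ p)
    (hθ : 0 ≤ θ) (hP0 : ∀ k l, P k l ≠ 0 → dist k l ≤ r) {d' : n → ℕ}
    (hPb : ∀ k l, |P k l| ≤ p * Real.exp (-(θ * d' k)))
    {d : n → ℕ} (hd : ∀ k l, d k ≤ dist k l + d l) {v : n → ℝ} {η : ℝ} (hη : 0 ≤ η)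
    (hv : ∀ l, |v l| ≤ η * Real.exp (-(θ * d l))) (k : n) :
    |(P *ᵥ v) k| ≤ Fintype.card n * p * η * Real.exp (θ * r) * Real.exp (-(θ * (d' k + d k))) := by
  rw [Matrix.mulVec, dotProduct]
  refine (Finset.abs_sum_le_sum_abs _ _).trans ?_
  have hterm : ∀ l, |P k l * v l| ≤ p * η * Real.exp (θ * r) * Real.exp (-(θ * (d' k + d k))) := by
    intro l
    by_cases h0 : P k l = 0
    · rw [h0, zero_mul, abs_zero]; positivity
    · have hr : (d k : ℝ) ≤ r + d l := by
        have h1 : d k ≤ dist k l + d l := hd k l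
        have h2 : dist k l ≤ r := hP0 k l h0
        exact_mod_cast h1.trans (Nat.add_le_add_right h2 _)
      rw [abs_mul]
      calc |P k l| * |v l| ≤ p * Real.exp (-(θ * d' k)) * (η * Real.exp (-(θ * d l))) :=
            mul_le_mul (hPb k l) (hv l) (abs_nonneg _) (by positivity)
        _ = p * η * (Real.exp (-(θ * d' k)) * Real.exp (-(θ * d l))) := by ring
        _ ≤ p * η * (Real.exp (θ * r) * Real.exp (-(θ * (d' k + d k)))) := by
            refine mul_le_mul_of_nonneg_left ?_ (mul_nonneg hp hη)
            rw [← Real.exp_add, ← Real.exp_add]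
            refine Real.exp_le_exp.2 ?_
            nlinarith
        _ = p * η * Real.exp (θ * r) * Real.exp (-(θ * (d' k + d k))) := by ring
  calc ∑ l, |P k l * v l| ≤ ∑ _l : n, p * η * Real.exp (θ * r) * Real.exp (-(θ * (d' k + d k))) :=
        Finset.sum_le_sum fun l _ => hterm l
    _ = Fintype.card n * p * η * Real.exp (θ * r) * Real.exp (-(θ * (d' k + d k))) := by
        rw [Finset.sum_const, Finset.card_univ, nsmul_eq_mul]; ring

omit [DecidableEq n] in
/-- The same, read globally when the two profiles are `R` apart at every index (`R ≤ d′ k + d k`, e.g. distances to two sets at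
distance `≥ R`): `|(P v) k| ≤ |n|·p·η·e^{θr}·e^{−θR}`. [cite: Balaban1985Variational, Thm 1 (10) p. 279] -/
theorem abs_mulVec_le_of_range_expLocalised_far (dist : n → n → ℕ) {P : Matrix n n ℝ} {p θ : ℝ} {r : ℕ} (hp : 0 ≤ p)
    (hθ : 0 ≤ θ) (hP0 : ∀ k l, P k l ≠ 0 → dist k l ≤ r) {d' : n → ℕ}
    (hPb : ∀ k l, |P k l| ≤ p * Real.exp (-(θ * d' k)))
    {d : n → ℕ} (hd : ∀ k l, d k ≤ dist k l + d l) {v : n → ℝ} {η : ℝ} (hη : 0 ≤ η)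
    (hv : ∀ l, |v l| ≤ η * Real.exp (-(θ * d l))) {R : ℕ} (hsep : ∀ k, R ≤ d' k + d k) (k : n) :
    |(P *ᵥ v) k| ≤ Fintype.card n * p * η * Real.exp (θ * r) * Real.exp (-(θ * R)) := by
  refine (abs_mulVec_le_of_range_expLocalised dist hp hθ hP0 hPb hd hη hv k).trans ?_
  refine mul_le_mul_of_nonneg_left (Real.exp_le_exp.2 ?_) (by positivity)
  have h : (R : ℝ) ≤ d' k + d k := by exact_mod_cast hsep k
  nlinarith

/-- ★★ **THE MIXED (SECOND-ORDER) RESPONSE ROW.**  Differentiating the response row `wₛ + A·mₛ = 0` once more (in the second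
bond variable) gives `u + P·mₛ + A·mₛₜ = 0` with `u = ∂ₜwₛ` (the explicit mixed source) and `P = ∂ₜA` (the variation of the
Hessian, range `r`, localised near the second profile `d′`).  If `|A⁻¹| ≤ C` entrywise, `|u| ≤ μ`, `mₛ` is localised near the
first profile (`|mₛ l| ≤ η·e^{−θ·d l}`) and the profiles are `R` apart at every index, then globally
`|mₛₜ k| ≤ |n|·C·(μ + |n|·p·η·e^{θr}·e^{−θR})` — the mixed response is as small as the explicit mixed source plus `e^{−θR}`.
[cite: Balaban1985Variational, Thm 1 (10) p. 279] -/
theorem abs_mixedResponse_le (dist : n → n → ℕ) {A P : Matrix n n ℝ} (hA : IsUnit A.det) {C : ℝ}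
    (hinv : ∀ k l, |A⁻¹ k l| ≤ C) {u ms mst : n → ℝ} (hrow : u + P *ᵥ ms + A *ᵥ mst = 0)
    {μ : ℝ} (hu : ∀ l, |u l| ≤ μ) {p θ : ℝ} {r : ℕ} (hp : 0 ≤ p) (hθ : 0 ≤ θ)
    (hP0 : ∀ k l, P k l ≠ 0 → dist k l ≤ r) {d' : n → ℕ} (hPb : ∀ k l, |P k l| ≤ p * Real.exp (-(θ * d' k)))
    {d : n → ℕ} (hd : ∀ k l, d k ≤ dist k l + d l) {η : ℝ} (hη : 0 ≤ η)
    (hms : ∀ l, |ms l| ≤ η * Real.exp (-(θ * d l))) {R : ℕ} (hsep : ∀ k, R ≤ d' k + d k) (k : n) :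
    |mst k| ≤ Fintype.card n * C *
      (μ + Fintype.card n * p * η * Real.exp (θ * r) * Real.exp (-(θ * R))) := by
  have hrow' : (u + P *ᵥ ms) + A *ᵥ mst = 0 := hrow
  rw [response_eq_neg_inv_mulVec hA hrow', Pi.neg_apply, abs_neg]
  refine abs_mulVec_le_card_mul A⁻¹ hinv (fun l => ?_) k
  rw [Pi.add_apply]
  exact (abs_add_le _ _).trans
    (add_le_add (hu l) (abs_mulVec_le_of_range_expLocalised_far dist hp hθ hP0 hPb hd hη hms hsep l))

end Literature.Analysis.Matrix

end
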